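import Summits.NavierStokesRegularity.NavierStokesRegularity.Theses.PerpetualPump
import Summits.NavierStokesRegularity.NavierStokesRegularity.Theorems.AveragedTypeIBlowup.Negative.NSReduction
import Summits.NavierStokesRegularity.NavierStokesRegularity.Theorems.AveragedTypeIBlowup.Negative.SymmetryRedundant
import Literature.Analysis.FluidPDE.TaoAveragedCascadeHolds
import Literature.Analysis.FunctionSpaces.FourierSobolevNormEmbeddingProofs

/-!
# Disproof of `Thesis` (stmt-NavierStokesRegularity-1832) — standing adversary's work file

Crux `Thesis` = the TARGET (rank 0) of route `PerpetualPump`: ABSTRACT TYPE-I EXCLUSION over Tao's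
averaging class — for every symmetric averaging datum `𝒜` with cancellation (Tao 2016 (1.12)–(1.16),
honest `L²/H¹⁰_df` class `Literature.Analysis.FluidPDE.Tao2016.AveragingDatum`), every Schwartz
divergence-free `u₀`, every `T > 0` and every `H¹⁰_df`-mild solution `u` on `[0,T)` with the Type-I rate
`‖u(t)‖_∞ ≤ M (T-t)^{-1/2}`, `u` extends as a mild solution past `T`.

A DISPROOF of this crux is a CONSTRUCTION: `¬ Thesis ↔ AveragedTypeIBlowup` (crux #3 of the route,
stmt-1835; §1). This file records what a disproof must and need not do, which hypotheses of `Thesis`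
carry weight, which strengthenings are refutable, and why no cheap kill exists. Every theorem is
sorry-free unless its docstring says NEAR-MISS. cdisprove seat
`refuter-cdisprove-stmt-NavierStokesRegularity-1832-0`, cycle 1 (2026-08-16).

## Findings (index)

1. `not_thesis_iff_averagedTypeIBlowup` / `thesis_iff_not_averagedTypeIBlowup` — the crux is the
   classical negation of crux #3 (imported from the landed `Negative/NSReduction.lean` of crux #3).
2. **REDUCTION OF ¬Thesis TO THE LOCAL CASCADE EQUATION (new, kernel-checked).** Tao's Theorem 3.2
   (every local cascade operator with fine dyadic parameter is an averaged Euler operator) is a THEOREM of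
   the tree (`localCascade_isAveraged_holds`). Hence `not_thesis_of_cascadeTypeIBlowup`: a Type-I-rate
   non-extendable `H¹⁰_df`-mild solution of a symmetric cancelling LOCAL CASCADE EQUATION (Tao (3.3)),
   available at arbitrarily fine dyadic parameter `ε₀`, already refutes `Thesis`. A disproof therefore
   never has to touch averaging data, multipliers, rotations or Theorem 3.2: its PDE content is exactly
   "cascade ODE pump + control of Lemma 4.1's inexact diagonalisation" (cruxes CircuitPump/PumpTransfer),
   and `PumpTransfer` may target `CascadeTypeIBlowup` instead of `AveragedTypeIBlowup` (planner note).
   Tool: `isMildSolutionFor_congr` (forms agreeing on `H¹⁰_df × H¹⁰_df × (H¹⁰_df ⊗ ℂ)` have the same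
   mild solutions on any initial time segment). §2' (prose): the cascade equation with Fourier-disjoint
   profiles is EXACTLY an autonomous scale-covariant Volterra chain (tree: `modeCoeff_eq_integral`), so
   the residual PDE content of a disproof is synthesis + the threshold question, with NO transfer error.
3. LOAD-BEARING ANALYSIS (the crux is UNIVERSAL, so a hypothesis `H` is load-bearing iff `Thesis` with
   `H` deleted is FALSE):
   * `thesis_iff_noSymm` — `IsSymmetric` is DECORATIVE (both directions; the equation only sees the
     quadratic form; symmetrisation, landed `Negative/SymmetryRedundant.lean` of crux #3).
   * `thesisShape_of_neg`, `thesisShape_zero_iff_localExistence` — `0 < T` is decorative except at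
     `T = 0`, where the statement IS local existence.
   * **`thesisWithoutRate_false_of_localExistence` (new, kernel-checked modulo local existence)** —
     the Type-I RATE hypothesis is load-bearing: with it deleted, `Thesis` says "every mild solution
     continues", which together with local existence yields GLOBAL mild solutions for every datum
     (`exists_global_of_forall_extends`, a Zorn argument on coherent families of mild solutions — no
     uniqueness needed), contradicting Tao's Theorem 1.5, a THEOREM of the tree
     (`averagedNS_blowup_holds`, axioms `propext/Classical.choice/Quot.sound` only). Local `H¹⁰_df`
     existence for averaged equations (Tao, remark after (1.15)) is standard but not in the tree; it is
     the hypothesis `LocalExistenceFor`.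
   * `thesisShape_of_nonpos` — the degenerate sector `M ≤ 0` of the rate hypothesis is TRUE for every
     datum (no loophole in the constant; `M > 0` WLOG `M = 1` by crux #3's cone lemma).
   * `HasCancellation`, `IsDivFree u₀`: prose (§3d) — no in-class statement is claimed.
4. NATURAL STRENGTHENINGS / NORMAL FORMS (§4): the conclusion cannot be strengthened to GLOBAL
   continuation (`thesisGlobal_false_of_localExistence`, from Theorem 1.5 again, via the embedding
   `H¹⁰ ⊂ L^∞` proved here as `eLpNorm_top_le_eFourierSobolevNorm`); the rate hypothesis may be
   restricted to any final interval `[t₀,T)` (`thesis_iff_eventualRate`, normal form for both sides); the rate EXPONENT `1/2` cannot be raised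
   (prose: Tao's witness has `‖u(t)‖_∞ ≈ (T-t)^{-3/5+O(ε)}`, p. 8 of arXiv:1402.0290: energy fraction
   `≥ (1+ε₀)^{-εn}` in `B(0,(1+ε₀)^{-n})` at times `T_* - t_n ≈ (1+ε₀)^{-(5/2-O(ε))n}`; and a dump-mode
   variant of his ABRUPT circuit is expected to realise every exponent in `(1/2, 3/5]`, §4b);
   the rate CONSTANT is not an invariant (`Thesis ↔` its `M = 1` version, crux #3's cone lemma).
5. WHY IT RESISTS (both ways, §5): `Thesis → NSMildTypeIExclusion` (it contains forward Type-I
   exclusion for Navier–Stokes itself — open, KNSS/Seregin–Šverák tier), so no cheap PROOF; and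
   `¬Thesis` needs an AUTONOMOUS in-class Type-I blow-up, of which none is in print (Tao's is Type II;
   the Type-I-rate dyadic witness `TruncatedDyadicTypeIBlowup` has an EXOGENOUS clock and is not a member
   of the class), so no cheap DISPROOF. The mechanism-level obstruction at `β = 1/2`: Type-I timing allows
   only `O(1)` dissipation times per scale step forever, which forbids the slow-ignition/abrupt-transfer
   time-scale separation that powers Tao's §5 circuit; a pump must fire within `O(1)` turnover times with
   `O(1)` losses at every scale (crux CircuitPump; numerics of the sibling seats: m = 1 scalar chain shows
   no autonomous pump at α = 2/5 — `Cruxes/CircuitPump/ScalarNumericsC1.md`, kit j008109/j008552/j009667 —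
   while an m = 2 seeded graded Toda chain shows k = 1 DSS Type-I threshold orbits at lam = 2, 1.5 —
   `Cruxes/CircuitPump/TRIAGE-r1-3.md` §A).

LANDINGS (Negative/ lane, `Theorems/Thesis/Negative/`, `--supports` 1832): `CascadeReduction.lean` (§2;
p83406 ACCEPTED), `RateLoadBearing.lean` (§3c; p85197 ACCEPTED; relation-form Zorn, no new definitions),
`TypeIRateNormalForm.lean` (§3d, §4a, §4a'; p85482 ACCEPTED; the embedding constant is existential there,
`exists_eLpNorm_top_le_eFourierSobolevNorm`) — import those rather than this work file once accepted.

VERDICT (cycle 1): no kill. `Thesis` is an honest open dichotomy (Tao's p. 8 footnote question at the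
`L^∞`-rate tier); its negation is a research-level construction whose formal PDE content is reduced here
to the cascade level; rate hypothesis load-bearing (mod local existence), symmetry decorative, exponent
and global-continuation strengthenings false, constant free.
-/

noncomputable section

set_option linter.dupNamespace false

namespace Summit.NavierStokesRegularity.NavierStokesRegularity.Cruxes.Thesis.Disproof

open MeasureTheory Set Filter Topology FourierTransform
open scoped ENNReal SchwartzMap
open Literature.Analysis.FluidPDE Literature.Analysis.FluidPDE.Tao2016
open Literature.Analysis.FunctionSpaces
open Summit.NavierStokesRegularity.NavierStokesRegularity.Theses.PerpetualPump
open Summit.NavierStokesRegularity.NavierStokesRegularity.Theorems.AveragedTypeIBlowup.Negative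

/-- Local notation for `ℝ³`. -/
local notation "ℝ³" => EuclideanSpace ℝ (Fin 3)

/-! ## 1. The crux and its constructive negation -/

/-- `¬ Thesis ↔ AveragedTypeIBlowup`: disproving the crux IS proving crux #3 (stmt-1835). [folklore] -/
theorem not_thesis_iff_averagedTypeIBlowup : ¬ Thesis ↔ AveragedTypeIBlowup :=
  averagedTypeIBlowup_iff_not_thesis.symm

/-- `Thesis ↔ ¬ AveragedTypeIBlowup`. [folklore] -/
theorem thesis_iff_not_averagedTypeIBlowup : Thesis ↔ ¬ AveragedTypeIBlowup := by
  rw [averagedTypeIBlowup_iff_not_thesis, not_not]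

/-- The route's own negative branch: cruxes #2 and #5 (`CircuitPump`, `PumpTransfer`) refute the target
(`PumpTransfer` is literally `CircuitPump → AveragedTypeIBlowup`, inlined). [folklore] -/
theorem not_thesis_of_circuitPump (hP : CircuitPump) (hT : PumpTransfer) : ¬ Thesis :=
  not_thesis_iff_averagedTypeIBlowup.2 (hT hP)

/-! ## 2. Reduction of `¬ Thesis` to the local cascade equation (Tao's Theorem 3.2 is in the tree) -/

/-- **Forms that agree on `H¹⁰_df × H¹⁰_df × (H¹⁰_df ⊗ ℂ)` have the same mild solutions** on every time
set `I ⊆ [0,∞)` containing `[0,t]` with each of its points `t`: the Duhamel identity (1.15)/(3.3) only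
evaluates the form at `(u(s), u(s), e^{(t-s)Δ}w)` with `u(s), w ∈ H¹⁰_df`, `0 ≤ s ≤ t`, and `e^{τΔ}`
maps `H¹⁰_df` into `H¹⁰_df ⊗ ℂ` (`MemH10dfC.heat`). This is the gluing step of Tao's "Theorem 1.5 ⇐
Theorems 3.2 + 3.3" (p. 14), isolated. [cite: Tao2016AveragedNS, §3 p. 14] -/
theorem isMildSolutionFor_congr {F₁ F₂ : L2C → L2C → L2C → ℂ}
    (h : ∀ u v w, MemH10df u → MemH10df v → MemH10dfC w → F₁ u v w = F₂ u v w)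
    {I : Set ℝ} (hI0 : I ⊆ Ici 0) (hI : ∀ t ∈ I, Icc 0 t ⊆ I) {a : L2C} {u : ℝ → L2C} :
    IsMildSolutionFor F₁ a I u ↔ IsMildSolutionFor F₂ a I u := by
  have key : ∀ {G₁ G₂ : L2C → L2C → L2C → ℂ},
      (∀ u v w, MemH10df u → MemH10df v → MemH10dfC w → G₁ u v w = G₂ u v w) →
      IsMildSolutionFor G₁ a I u → IsMildSolutionFor G₂ a I u := by
    intro G₁ G₂ hG hu
    refine ⟨hu.1, hu.2.1, fun t ht w hw => ?_⟩
    rw [hu.2.2 t ht w hw]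
    congr 1
    refine intervalIntegral.integral_congr fun s hs => ?_
    have ht0 : (0 : ℝ) ≤ t := hI0 ht
    rw [uIcc_of_le ht0] at hs
    have hsI : s ∈ I := hI t ht hs
    exact hG _ _ _ (hu.1 s hsI) (hu.1 s hsI) (hw.memH10dfC.heat _)
  exact ⟨key h, key fun u v w hu hv hw => (h u v w hu hv hw).symm⟩

/-- Initial segments `[0,S)` satisfy the hypotheses of `isMildSolutionFor_congr`. [folklore] -/
theorem Icc_subset_Ico_of_mem {S t : ℝ} (ht : t ∈ Ico (0 : ℝ) S) : Icc 0 t ⊆ Ico 0 S :=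
  fun _ hs => ⟨hs.1, hs.2.trans_lt ht.2⟩

/-- **Type-I blow-up for a local cascade equation at dyadic parameter `ε₀`** (the cascade-level face of
crux #3): a symmetric local cascade form `C` (Tao Def. 3.1) with the cancellation (3.2), a Schwartz
divergence-free datum, a time `S > 0` and an `H¹⁰_df`-mild solution of (3.3) `∂ₜu = Δu + C(u,u)` on
`[0,S)` at the Type-I rate `‖u(t)‖_∞ ≤ M (S-t)^{-1/2}` with NO mild extension past `S`.
[cite: Tao2016AveragedNS, Def. 3.1, (3.2)–(3.3)] -/
def CascadeTypeIBlowupAt (ε₀ : ℝ) : Prop :=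
  ∃ C : L2C → L2C → L2C → ℂ, IsLocalCascadeForm ε₀ C ∧
    (∀ u v w, MemH10df u → MemH10df v → MemH10df w → C u v w = C v u w) ∧
    (∀ u, MemH10df u → C u u u = 0) ∧
    ∃ u₀ : 𝓢(ℝ³, ℝ³), VectorCalculus.IsDivFree ⇑u₀ ∧ ∃ S : ℝ, 0 < S ∧ ∃ u : ℝ → L2C,
      IsMildSolutionFor C (schwartzL2 u₀) (Ico 0 S) u ∧
      (∃ M : ℝ, ∀ t ∈ Ico 0 S, eLpNorm (u t) ⊤ volume ≤ ENNReal.ofReal (M / Real.sqrt (S - t))) ∧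
      ¬ ∃ S' : ℝ, S < S' ∧ ∃ v : ℝ → L2C,
        IsMildSolutionFor C (schwartzL2 u₀) (Ico 0 S') v ∧ ∀ t ∈ Ico 0 S, v t = u t

/-- **Type-I blow-up for local cascade equations at arbitrarily fine dyadic parameter** (the shape
forced by Theorem 3.2, whose smallness threshold `ε₁` on `ε₀` is existential; cf. the
`∀ lam₀ > 1, ∃ lam ∈ (1, lam₀)` wrapper of crux CircuitPump). [cite: Tao2016AveragedNS, Thm. 3.2] -/
def CascadeTypeIBlowup : Prop :=
  ∀ ε₁ : ℝ, 0 < ε₁ → ∃ ε₀ : ℝ, 0 < ε₀ ∧ ε₀ ≤ ε₁ ∧ CascadeTypeIBlowupAt ε₀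

/-- **Crux #3 from its cascade-level face**: a Type-I blow-up of a local cascade equation at fine enough
dyadic parameter is a Type-I blow-up of an averaged Navier–Stokes equation — by Theorem 3.2
(`localCascade_isAveraged_holds`, a theorem of the tree) and the gluing `isMildSolutionFor_congr`
(symmetry and cancellation transfer verbatim, mild solutions and mild extensions correspond both ways,
the rate conjunct is untouched). [cite: Tao2016AveragedNS, Thm. 3.2 and §3 p. 14] -/
theorem averagedTypeIBlowup_of_cascadeTypeIBlowup (h : CascadeTypeIBlowup) : AveragedTypeIBlowup := by
  obtain ⟨ε₁, hε₁, h32⟩ := localCascade_isAveraged_holds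
  obtain ⟨ε₀, hε₀, hle, C, hC, hsymm, hcanc, u₀, hdiv, S, hS, u, hmild, hrate, hno⟩ := h ε₁ hε₁
  obtain ⟨𝒜, h𝒜⟩ := h32 ε₀ hε₀ hle C hC
  have hcongr : ∀ (R : ℝ) (v : ℝ → L2C),
      IsMildSolutionFor 𝒜.form (schwartzL2 u₀) (Ico 0 R) v ↔
        IsMildSolutionFor C (schwartzL2 u₀) (Ico 0 R) v :=
    fun R v => isMildSolutionFor_congr h𝒜 (fun t ht => ht.1) (fun t ht => Icc_subset_Ico_of_mem ht)
  refine ⟨𝒜, fun a b c ha hb hc => ?_, fun a ha => ?_, u₀, hdiv, S, hS, u, (hcongr S u).2 hmild,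
    hrate, ?_⟩
  · rw [h𝒜 a b c ha hb hc.memH10dfC, h𝒜 b a c hb ha hc.memH10dfC]
    exact hsymm a b c ha hb hc
  · rw [h𝒜 a a a ha ha ha.memH10dfC]
    exact hcanc a ha
  · rintro ⟨S', hSS', v, hv, hvu⟩
    exact hno ⟨S', hSS', v, (hcongr S' v).1 hv, hvu⟩

/-- **`¬ Thesis` from a cascade-level Type-I blow-up.** A disproof of the crux never has to touch
averaging data: its PDE content is exactly a Type-I-rate non-extendable mild solution of some symmetric
cancelling local cascade equation (3.3) at fine dyadic parameter. [cite: Tao2016AveragedNS, Thm. 3.2] -/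
theorem not_thesis_of_cascadeTypeIBlowup (h : CascadeTypeIBlowup) : ¬ Thesis :=
  not_thesis_iff_averagedTypeIBlowup.2 (averagedTypeIBlowup_of_cascadeTypeIBlowup h)

/-! ### 2'. The next reduction (prose): the EXACT Volterra face of the cascade equation

For a local cascade form whose profiles `ψ_{j,i}` have pairwise DISJOINT Fourier supports (Tao's choice,
§4 (4.1)), the cascade PDE (3.3) closes EXACTLY on the mode coefficients: the heat propagator is a
Fourier multiplier, so `⟨e^{τΔ}ψ_{i,n}, ψ_{i',n'}⟩ = 0` unless `(i,n) = (i',n')`, and by the Duhamel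
identity each `X_{i,n}(t) = ⟨u(t), ψ_{i,n}⟩` obeys the VOLTERRA equation
`X_{i,n}(t) = ⟨e^{tΔ}u₀, ψ_{i,n}⟩ + ∫₀ᵗ Q_{i,n}(X(s)) k_{i,n}(t-s) ds`,
`k_{i,n}(τ) = ∫ e^{-4π²τ|ξ|²} |ψ̂_{i,n}(ξ)|² dξ` (a completely monotone kernel, a narrow mixture of
exponentials with rates in the band `4π²(1+ε₀)^{2n}[ (1-2ε₀)², (1+2ε₀)² ]`), `Q_{i,n}` the quadratic
forcing of (4.3) — this is the content of the tree's `TaoCascadeDuhamel.lean`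
(`modeCoeff_eq_integral`: `X_{i,n}(t) = ∫ Re m_t |ψ̂_{i,n}|²`, `m_t = δ e^{-4π²t|ξ|²} + M_t`), i.e. Tao's
"inexact diagonalisation" made exact as MEMORY rather than error. The kernels are exact dilates of
one another when the `ψ_{i,n}` are (`cascadeWavelet`), so the Volterra chain is autonomous and exactly
scale-covariant. Consequently a disproof of `Thesis` can be organised as: (V1) an exactly-DSS (or merely
Type-I, forward, from finitely many excited modes) blow-up solution of the VOLTERRA chain — crux
CircuitPump with `e^{-λ_n τ}` replaced by `k_n(τ)`; (V2) SYNTHESIS: from a chain solution `X` define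
`u(t) = e^{tΔ}u₀ + Σ_{i,n} M^{(i,n)}_t(D) ψ_{i,n}` and prove it is an `H¹⁰_df`-mild solution of (3.3)
with `‖u(t)‖_∞ ≲ Σ_n |X_n(t)| N_n^{3/2} ‖ψ̂‖_{L¹}` (Type I iff the chain is: active scale `N`, amplitude
`N^{-1/2}`, `‖·‖_∞ ≈ N ≈ (T-t)^{-1/2}`) and `‖u(t)‖_{H¹⁰} → ∞`; (V3) no transfer error remains — the
only analytic input of PumpTransfer left is the THRESHOLD/STABILITY question of reaching the DSS regime
from a finitely-supported (Schwartz) datum (a DSS chain solution is ancient with infinite energy in the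
low modes, `E_n ≈ N_n^{-1}`, `n → -∞`). (V2) is the analysis→synthesis converse of the tree's Lemma 4.1
files and is not formalised; recorded for the planner (cf. idea card exact-volterra-embedding of crux #3's
round 1) as the sharpest currently statable form of "¬Thesis needs only an ODE-type object". -/

/-! ## 3. Load-bearing analysis of the hypotheses of `Thesis` -/

/-! ### 3a. `IsSymmetric` is decorative -/

/-- `Thesis` with the hypothesis `IsSymmetric` deleted: Type-I exclusion for ALL averaging data with the
cancellation property (1.16). [folklore] -/
def ThesisNoSymm : Prop :=
  ∀ 𝒜 : AveragingDatum, 𝒜.HasCancellation → ∀ u₀ : 𝓢(ℝ³, ℝ³), VectorCalculus.IsDivFree ⇑u₀ →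
    ∀ T : ℝ, 0 < T → ∀ u : ℝ → L2C, 𝒜.IsMildSolution (schwartzL2 u₀) (Ico 0 T) u →
      (∃ M : ℝ, ∀ t ∈ Ico 0 T, eLpNorm (u t) ⊤ volume ≤ ENNReal.ofReal (M / Real.sqrt (T - t))) →
        ∃ T' : ℝ, T < T' ∧ ∃ v : ℝ → L2C,
          𝒜.IsMildSolution (schwartzL2 u₀) (Ico 0 T') v ∧ ∀ t ∈ Ico 0 T, v t = u t

/-- **`IsSymmetric` is decorative**: `Thesis ↔ ThesisNoSymm`. The averaged equation only sees the
quadratic form `u ↦ B̃(u,u)`, which the symmetrisation of a datum leaves unchanged (`thesis_noSymm`,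
landed for crux #3); the converse direction is weakening. So no proof of `Thesis` can use symmetry in an
essential way, and a counterexample may be sought among NON-symmetric data with (1.16). [folklore] -/
theorem thesis_iff_noSymm : Thesis ↔ ThesisNoSymm :=
  ⟨fun h 𝒜 hc => thesis_noSymm h 𝒜 hc, fun h 𝒜 _ hc => h 𝒜 hc⟩

/-! ### 3b. `0 < T` is decorative except at `T = 0`, where the statement is local existence -/

/-- The conclusion-shape of `Thesis` for a datum class `a`, a time `T` and a curve `u`. [folklore] -/
def ThesisShape (𝒜 : AveragingDatum) (a : L2C) (T : ℝ) (u : ℝ → L2C) : Prop :=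
  ∃ T' : ℝ, T < T' ∧ ∃ v : ℝ → L2C, 𝒜.IsMildSolution a (Ico 0 T') v ∧ ∀ t ∈ Ico 0 T, v t = u t

/-- A curve is (vacuously) a mild solution on the empty time set. [folklore] -/
theorem isMildSolutionFor_empty (F : L2C → L2C → L2C → ℂ) (a : L2C) (u : ℝ → L2C) :
    IsMildSolutionFor F a ∅ u :=
  ⟨fun _ h => h.elim, fun _ h => h.elim, fun _ h => h.elim⟩

/-- For NEGATIVE `T` the conclusion of `Thesis` holds for every datum and every curve (take
`T' = T/2 < 0`: the time set `[0,T')` is empty). So the guard `0 < T` only matters at `T = 0`. [folklore] -/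
theorem thesisShape_of_neg (𝒜 : AveragingDatum) (a : L2C) {T : ℝ} (hT : T < 0) (u : ℝ → L2C) :
    ThesisShape 𝒜 a T u := by
  refine ⟨T / 2, by linarith, u, ?_, fun _ _ => rfl⟩
  have h : Ico (0 : ℝ) (T / 2) = ∅ := Ico_eq_empty (by intro h; linarith)
  rw [AveragingDatum.IsMildSolution, h]
  exact isMildSolutionFor_empty _ _ _

/-- At `T = 0` the hypotheses of `Thesis` are vacuous (`[0,0) = ∅`) and its conclusion IS local
existence of a mild solution from `a`: the guard `0 < T` removes exactly the local-existence content
from the crux. [folklore] -/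
theorem thesisShape_zero_iff_localExistence (𝒜 : AveragingDatum) (a : L2C) (u : ℝ → L2C) :
    ThesisShape 𝒜 a 0 u ↔ ∃ T' : ℝ, 0 < T' ∧ ∃ v : ℝ → L2C, 𝒜.IsMildSolution a (Ico 0 T') v := by
  unfold ThesisShape
  simp only [Ico_self, mem_empty_iff_false, false_imp_iff, imp_true_iff, and_true]

/-! ### 3c. The Type-I rate hypothesis is load-bearing (modulo local existence): Theorem 1.5 bites -/

/-- `Thesis` with the Type-I rate hypothesis deleted: unconditional continuation of mild solutions.
[folklore] -/
def ThesisWithoutRate : Prop :=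
  ∀ 𝒜 : AveragingDatum, 𝒜.IsSymmetric → 𝒜.HasCancellation → ∀ u₀ : 𝓢(ℝ³, ℝ³),
    VectorCalculus.IsDivFree ⇑u₀ → ∀ T : ℝ, 0 < T → ∀ u : ℝ → L2C,
      𝒜.IsMildSolution (schwartzL2 u₀) (Ico 0 T) u →
        ∃ T' : ℝ, T < T' ∧ ∃ v : ℝ → L2C,
          𝒜.IsMildSolution (schwartzL2 u₀) (Ico 0 T') v ∧ ∀ t ∈ Ico 0 T, v t = u t

/-- **Local existence of `H¹⁰_df`-mild solutions for the averaged equation driven by `𝒜`** from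
Schwartz divergence-free data (Tao 2016, remark after (1.15): standard energy/semigroup method, since
`B̃ : H¹⁰_df × H¹⁰_df → H⁹` and `e^{τΔ} : H⁹ → H¹⁰` with norm `O(τ^{-1/2})`). TRUE for every averaging
datum; not in the tree. The hypothesis of the two negative lemmas below. [cite: Tao2016AveragedNS, §1.1 after (1.15)] -/
def LocalExistenceFor (𝒜 : AveragingDatum) : Prop :=
  ∀ u₀ : 𝓢(ℝ³, ℝ³), VectorCalculus.IsDivFree ⇑u₀ →
    ∃ T : ℝ, 0 < T ∧ ∃ u : ℝ → L2C, 𝒜.IsMildSolution (schwartzL2 u₀) (Ico 0 T) u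

/-- A mild solution of `∂ₜu = Δu + F(u,u)` from `a` on an initial segment `[0,T)`, `T > 0` (the
elements of the Zorn poset). [folklore] -/
structure MildChunk (F : L2C → L2C → L2C → ℂ) (a : L2C) where
  /-- the length of the time segment -/
  T : ℝ
  /-- the curve -/
  u : ℝ → L2C
  /-- positivity of the length -/
  pos : 0 < T
  /-- the mild-solution property on `[0,T)` -/
  mild : IsMildSolutionFor F a (Ico 0 T) u

namespace MildChunk

variable {F : L2C → L2C → L2C → ℂ} {a : L2C}

/-- Extension order: `p ≤ q` iff `q` lives at least as long and agrees with `p` on `[0, p.T)`. A preorder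
(not antisymmetric: curves may differ outside their segments). [folklore] -/
instance : Preorder (MildChunk F a) where
  le p q := p.T ≤ q.T ∧ ∀ t ∈ Ico 0 p.T, q.u t = p.u t
  le_refl _ := ⟨le_rfl, fun _ _ => rfl⟩
  le_trans p q r hpq hqr :=
    ⟨hpq.1.trans hqr.1, fun t ht => (hqr.2 t ⟨ht.1, ht.2.trans_le hpq.1⟩).trans (hpq.2 t ht)⟩

theorem le_def (p q : MildChunk F a) : p ≤ q ↔ p.T ≤ q.T ∧ ∀ t ∈ Ico 0 p.T, q.u t = p.u t := Iff.rfl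

/-- The time set covered by a family of chunks: `⋃_{p ∈ c} [0, p.T)`. [folklore] -/
def glueSet (c : Set (MildChunk F a)) : Set ℝ := {t | 0 ≤ t ∧ ∃ p ∈ c, t < p.T}

open Classical in
/-- The glued curve of a family of chunks (any member alive at `t`; `0` off the covered set). [folklore] -/
def glue (c : Set (MildChunk F a)) (t : ℝ) : L2C :=
  if h : ∃ p ∈ c, t < p.T then h.choose.u t else 0

/-- On a CHAIN the glued curve agrees with every member on that member's segment. [folklore] -/
theorem glue_eq {c : Set (MildChunk F a)} (hc : IsChain (· ≤ ·) c) {p : MildChunk F a} (hp : p ∈ c)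
    {t : ℝ} (ht : t ∈ Ico 0 p.T) : glue c t = p.u t := by
  have h : ∃ q ∈ c, t < q.T := ⟨p, hp, ht.2⟩
  unfold glue
  rw [dif_pos h]
  have hqc : h.choose ∈ c := h.choose_spec.1
  have htq : t < h.choose.T := h.choose_spec.2
  by_cases hne : h.choose = p
  · rw [hne]
  · rcases hc hqc hp hne with hqp | hpq
    · exact (hqp.2 t ⟨ht.1, htq⟩).symm
    · exact hpq.2 t ht

/-- **Gluing a chain of mild solutions gives a mild solution on the union of their segments** (membership
and the Duhamel identity are pointwise in `t` and only look back at `[0,t]`; `H¹⁰`-continuity within the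
union at `t₀` is that of any member alive at `t₀`, the union agreeing with that member's segment below
its lifetime). [folklore] -/
theorem glue_mild {c : Set (MildChunk F a)} (hc : IsChain (· ≤ ·) c) :
    IsMildSolutionFor F a (glueSet c) (glue c) := by
  refine ⟨fun t ht => ?_, fun t₀ ht₀ => ?_, fun t ht w hw => ?_⟩
  · obtain ⟨ht0, p, hp, htp⟩ := ht
    rw [glue_eq hc hp ⟨ht0, htp⟩]
    exact p.mild.1 t ⟨ht0, htp⟩
  · obtain ⟨ht0, p, hp, htp⟩ := ht₀
    have hset : glueSet c ∩ Iio p.T = Ico 0 p.T := by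
      ext t
      constructor
      · rintro ⟨⟨h0, -⟩, hlt⟩
        exact ⟨h0, hlt⟩
      · intro h
        exact ⟨⟨h.1, p, hp, h.2⟩, h.2⟩
    have hnhds : 𝓝[glueSet c] t₀ = 𝓝[Ico 0 p.T] t₀ := by
      rw [nhdsWithin_restrict' (glueSet c) (Iio_mem_nhds htp), hset]
    have key := p.mild.2.1 t₀ ⟨ht0, htp⟩
    rw [hnhds]
    refine key.congr' ?_
    filter_upwards [self_mem_nhdsWithin] with t ht
    rw [glue_eq hc hp ht, glue_eq hc hp ⟨ht0, htp⟩]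
  · obtain ⟨ht0, p, hp, htp⟩ := ht
    have htI : t ∈ Ico 0 p.T := ⟨ht0, htp⟩
    rw [glue_eq hc hp htI, p.mild.2.2 t htI w hw]
    congr 1
    refine intervalIntegral.integral_congr fun s hs => ?_
    rw [uIcc_of_le ht0] at hs
    rw [glue_eq hc hp ⟨hs.1, hs.2.trans_lt htp⟩]

end MildChunk

/-- **Continuation + local existence ⇒ global existence** (Zorn on coherent families of mild solutions;
no uniqueness theory is used). If some mild solution from `a` exists on some `[0,T₀)`, and EVERY mild
solution on EVERY `[0,T)` extends to a mild solution on a strictly longer `[0,T')` agreeing with it, then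
there is a global mild solution `u : [0,∞) → H¹⁰_df`. (A maximal element of the extension preorder
exists because chains glue — to a longer chunk if their lifetimes are bounded, to a global solution
otherwise — and a maximal chunk contradicts the continuation hypothesis.) [folklore] -/
theorem exists_global_of_forall_extends {F : L2C → L2C → L2C → ℂ} {a : L2C}
    (hloc : ∃ T : ℝ, 0 < T ∧ ∃ u : ℝ → L2C, IsMildSolutionFor F a (Ico 0 T) u)
    (hext : ∀ T : ℝ, 0 < T → ∀ u : ℝ → L2C, IsMildSolutionFor F a (Ico 0 T) u →
      ∃ T' : ℝ, T < T' ∧ ∃ v : ℝ → L2C, IsMildSolutionFor F a (Ico 0 T') v ∧ ∀ t ∈ Ico 0 T, v t = u t) :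
    ∃ u : ℝ → L2C, IsMildSolutionFor F a (Ici 0) u := by
  by_contra hno
  obtain ⟨T₀, hT₀, u₀, hu₀⟩ := hloc
  haveI : Nonempty (MildChunk F a) := ⟨⟨T₀, u₀, hT₀, hu₀⟩⟩
  have hchain : ∀ c : Set (MildChunk F a), IsChain (· ≤ ·) c → c.Nonempty → BddAbove c := by
    intro c hc hne
    obtain ⟨p₀, hp₀⟩ := hne
    by_cases hbdd : BddAbove (MildChunk.T '' c)
    · have himg : (MildChunk.T '' c).Nonempty := ⟨p₀.T, p₀, hp₀, rfl⟩
      have hSpos : 0 < sSup (MildChunk.T '' c) :=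
        p₀.pos.trans_le (le_csSup hbdd ⟨p₀, hp₀, rfl⟩)
      have hset : MildChunk.glueSet c = Ico 0 (sSup (MildChunk.T '' c)) := by
        ext t
        constructor
        · rintro ⟨h0, p, hp, htp⟩
          exact ⟨h0, htp.trans_le (le_csSup hbdd ⟨p, hp, rfl⟩)⟩
        · rintro ⟨h0, htS⟩
          obtain ⟨_, ⟨p, hp, rfl⟩, htp⟩ := exists_lt_of_lt_csSup himg htS
          exact ⟨h0, p, hp, htp⟩
      have hmild := MildChunk.glue_mild hc
      rw [hset] at hmild
      refine ⟨⟨sSup (MildChunk.T '' c), MildChunk.glue c, hSpos, hmild⟩, fun p hp => ?_⟩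
      exact ⟨le_csSup hbdd ⟨p, hp, rfl⟩, fun t ht => MildChunk.glue_eq hc hp ht⟩
    · exfalso
      apply hno
      refine ⟨MildChunk.glue c, ?_⟩
      have hset : MildChunk.glueSet c = Ici 0 := by
        ext t
        constructor
        · rintro ⟨h0, -⟩
          exact h0
        · intro h0
          obtain ⟨_, ⟨p, hp, rfl⟩, htp⟩ := not_bddAbove_iff.1 hbdd t
          exact ⟨h0, p, hp, htp⟩
      have hmild := MildChunk.glue_mild hc
      rwa [hset] at hmild
  obtain ⟨m, hm⟩ := zorn_le_nonempty hchain
  obtain ⟨T', hT', v, hv, hvu⟩ := hext m.T m.pos m.u m.mild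
  have hle : m ≤ ⟨T', v, m.pos.trans hT', hv⟩ := ⟨hT'.le, hvu⟩
  have hge : T' ≤ m.T := (hm hle).1
  exact absurd hge (not_le.2 hT')

/-- **Theorem 1.5 in local form, modulo local existence**: some symmetric averaging datum with
cancellation has a Schwartz divergence-free datum and a mild solution on some `[0,T)`, `T > 0`, admitting
NO mild extension past `T` (the crux AveragedTypeIBlowup without its rate conjunct). From
`averagedNS_blowup_holds` (Theorem 1.5, a theorem of the tree) and `exists_global_of_forall_extends`.
[cite: Tao2016AveragedNS, Thm. 1.5] -/
theorem exists_nonextendable_of_localExistence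
    (hloc : ∀ 𝒜 : AveragingDatum, 𝒜.IsSymmetric → 𝒜.HasCancellation → LocalExistenceFor 𝒜) :
    ∃ 𝒜 : AveragingDatum, 𝒜.IsSymmetric ∧ 𝒜.HasCancellation ∧
      ∃ u₀ : 𝓢(ℝ³, ℝ³), VectorCalculus.IsDivFree ⇑u₀ ∧ ∃ T : ℝ, 0 < T ∧ ∃ u : ℝ → L2C,
        𝒜.IsMildSolution (schwartzL2 u₀) (Ico 0 T) u ∧
        ¬ ∃ T' : ℝ, T < T' ∧ ∃ v : ℝ → L2C,
          𝒜.IsMildSolution (schwartzL2 u₀) (Ico 0 T') v ∧ ∀ t ∈ Ico 0 T, v t = u t := by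
  obtain ⟨𝒜, hs, hc, u₀, hdiv, hno⟩ := averagedNS_blowup_holds
  refine ⟨𝒜, hs, hc, u₀, hdiv, ?_⟩
  by_contra hall
  push Not at hall
  exact hno (exists_global_of_forall_extends (hloc 𝒜 hs hc u₀ hdiv)
    fun T hT u hu => hall T hT u hu)

/-- **The Type-I rate hypothesis of `Thesis` is load-bearing** (modulo local existence): with it deleted
the statement contradicts Tao's Theorem 1.5 (`averagedNS_blowup_holds`), because continuation of every
mild solution plus local existence gives global solutions (`exists_global_of_forall_extends`). Any
proof of `Thesis` must therefore USE the bound `‖u(t)‖_∞ ≤ M(T-t)^{-1/2}` near `T`; conversely the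
disprover's witness must be a genuine finite-time singularity (Theorem 1.5 supplies those) whose RATE is
Type I (Theorem 1.5's is not: `(T-t)^{-3/5+O(ε)}`, p. 8). [cite: Tao2016AveragedNS, Thm. 1.5 and §1.1 footnote p. 8] -/
theorem thesisWithoutRate_false_of_localExistence
    (hloc : ∀ 𝒜 : AveragingDatum, 𝒜.IsSymmetric → 𝒜.HasCancellation → LocalExistenceFor 𝒜) :
    ¬ ThesisWithoutRate := by
  intro h
  obtain ⟨𝒜, hs, hc, u₀, hdiv, T, hT, u, hmild, hno⟩ := exists_nonextendable_of_localExistence hloc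
  exact hno (h 𝒜 hs hc u₀ hdiv T hT u hmild)

/-- The converse bookkeeping: `Thesis` is `ThesisWithoutRate` restricted to Type-I-bounded curves, so
`ThesisWithoutRate → Thesis` (the deleted hypothesis only weakens). [folklore] -/
theorem thesis_of_thesisWithoutRate (h : ThesisWithoutRate) : Thesis :=
  fun 𝒜 hs hc u₀ hdiv T hT u hmild _ => h 𝒜 hs hc u₀ hdiv T hT u hmild

/-! ### 3d. The remaining hypotheses (prose; no in-class statement claimed)

* `HasCancellation` deleted: without the energy identity (1.16) finite-time blow-up for NS-like equations
  is cheap in print (Montgomery-Smith 2001, barrier `CheapNavierStokesBlowup`), but the printed witnesses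
  are scalar / not of the form `B̃`, and their RATE is not known to be Type I; so even
  `Thesis`-without-cancellation has no cheap in-class counterexample on record. (For the disprover this
  is sobering: even with the strongest structural hypothesis removed nobody has written down a Type-I-rate
  singularity of a 3-D incompressible NS-like system; the nearest is Tao's ODE Prop. 5.1 at the endpoint,
  `TruncatedDyadicTypeIBlowup`, whose clock is exogenous.)
* `IsDivFree u₀` deleted: the mild identity (1.15) is an identity in `(H¹⁰_df)*`, so only the Leray
  projection of `u₀` is seen; a non-solenoidal Schwartz `u₀` is the solenoidal NON-Schwartz datum `P u₀`
  (decay `|x|^{-3}`), a slightly larger data class — no cheap counterexample either.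
* the constant `M`: the degenerate sector `M ≤ 0` is TRUE (`thesisShape_of_nonpos` below: `u ≡ 0`,
  then `a ⊥ H¹⁰_df` and `v ≡ 0` extends) — no loophole; and for `M > 0` the value of `M` is
  immaterial: `Thesis ↔` its `M = 1` version, because averaging data form a cone (`rscale`, crux #3's
  `averagedTypeIBlowup_iff_unitRate`, Cruxes/AveragedTypeIBlowup §8): no proof of `Thesis` can be
  perturbative in `M`, and a counterexample may be normalised to any `M > 0`. -/

/-- **The degenerate sector `M ≤ 0` of `Thesis` is TRUE (for every averaging datum and every datum
class).** A Type-I bound with constant `M ≤ 0` forces `u(t) = 0` in `L²` for all `t ∈ [0,T)`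
(`‖u(t)‖_{L^∞} ≤ 0`); the mild identity at `t = 0` then gives `⟨a, w⟩ = 0` for every `w ∈ H¹⁰_df`,
whence `⟨e^{tΔ}a, w⟩ = ⟨a, e^{tΔ}w⟩ = 0` (`pairing_heat_left`, `MemH10df.heat`) for ALL `t ≥ 0`, and
`v ≡ 0` is a global mild solution from `a` extending `u`. So the constant carries no degenerate
loophole: a disprover's witness has `M > 0` (and then WLOG `M = 1`, crux #3's cone lemma). [folklore] -/
theorem thesisShape_of_nonpos (𝒜 : AveragingDatum) (a : L2C) {T M : ℝ} (hT : 0 < T) (hM : M ≤ 0)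
    {u : ℝ → L2C} (hu : 𝒜.IsMildSolution a (Ico 0 T) u)
    (hrate : ∀ t ∈ Ico 0 T, eLpNorm (u t) ⊤ volume ≤ ENNReal.ofReal (M / Real.sqrt (T - t))) :
    ∃ T' : ℝ, T < T' ∧ ∃ v : ℝ → L2C, 𝒜.IsMildSolution a (Ico 0 T') v ∧ ∀ t ∈ Ico 0 T, v t = u t := by
  have hzero : ∀ t ∈ Ico 0 T, u t = 0 := by
    intro t ht
    have h0 : ENNReal.ofReal (M / Real.sqrt (T - t)) = 0 :=
      ENNReal.ofReal_eq_zero.2 (div_nonpos_of_nonpos_of_nonneg hM (Real.sqrt_nonneg _))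
    have h1 : eLpNorm (u t) ⊤ volume = 0 := nonpos_iff_eq_zero.1 (h0 ▸ hrate t ht)
    rw [eLpNorm_eq_zero_iff (Lp.aestronglyMeasurable (u t)) ENNReal.top_ne_zero] at h1
    exact Lp.eq_zero_iff_ae_eq_zero.2 h1
  have hu' : IsMildSolutionFor 𝒜.form a (Ico 0 T) u := hu
  have horth : ∀ w, MemH10df w → pairing a w = 0 := by
    intro w hw
    have h := hu'.2.2 0 ⟨le_rfl, hT⟩ w hw
    rw [hzero 0 ⟨le_rfl, hT⟩, intervalIntegral.integral_same, add_zero, heat_zero,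
      pairing_zero_left] at h
    exact h.symm
  refine ⟨T + 1, by linarith, fun _ => 0, ⟨fun _ _ => memH10df_zero, continuousInH10On_zero _,
    fun t _ w hw => ?_⟩, fun t ht => (hzero t ht).symm⟩
  simp only [AveragingDatum.form_zero_left, intervalIntegral.integral_zero, add_zero, pairing_zero_left]
  rw [pairing_heat_left]
  exact (horth _ (hw.heat t)).symm

/-! ## 4. Natural strengthenings of `Thesis` that are FALSE

### 4a. The conclusion cannot be strengthened to GLOBAL continuation (modulo local existence) -/

/-- The constant of the embedding `H¹⁰(ℝ³) ⊂ L^∞(ℝ³)`: `K = (∫ (1+|ξ|²)^{-10} dξ)^{1/2}`. [folklore] -/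
def supConst : ℝ≥0∞ :=
  (∫⁻ ξ : ℝ³, ENNReal.ofReal ((1 + ‖ξ‖ ^ 2) ^ (-10 : ℝ))) ^ (1 / 2 : ℝ)

/-- `K < ∞` (`20 > 3`). [folklore] -/
theorem supConst_lt_top : supConst < ∞ :=
  ENNReal.rpow_lt_top_of_nonneg (by norm_num) lintegral_inv_sobolevWeight_lt_top.ne

/-- **`H¹⁰(ℝ³) ⊂ L^∞(ℝ³)` on Tao's ambient space**: `‖u‖_{L^∞} ≤ ‖û‖_{L¹} ≤ K ‖u‖_{H¹⁰}` for every
`u ∈ L²(ℝ³; ℂ³)` of finite `H¹⁰` norm (Cauchy–Schwarz against `(1+|ξ|²)^{-10} ∈ L¹`, accepted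
`lintegral_enorm_le_sobolevWeight`; the `L²` inverse transform of `û ∈ L¹ ∩ L²` is a.e. bounded by
`∫ |û|`, accepted `SobolevEmbeddingHalf.enorm_fourierInv_toLp_le`; and `𝓕⁻¹𝓕u = u`). This is the
"`H¹⁰ ⊂ L^∞`" used informally all over the route (e.g. "on `[0,T-δ]` an `H¹⁰`-continuous curve is bounded
in `L^∞`"). [folklore] -/
theorem eLpNorm_top_le_eFourierSobolevNorm (u : L2C) (hu : eFourierSobolevNorm 10 u < ∞) :
    eLpNorm (u : ℝ³ → EuclideanSpace ℂ (Fin 3)) ⊤ volume ≤ supConst * eFourierSobolevNorm 10 u := by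
  have hL1 : ∫⁻ ξ, ‖fourierFn u ξ‖ₑ ≤ supConst * eFourierSobolevNorm 10 u := by
    rw [eFourierSobolevNorm_eq]
    exact lintegral_enorm_le_sobolevWeight (aestronglyMeasurable_fourierFn u)
  have hfin : ∫⁻ ξ, ‖fourierFn u ξ‖ₑ < ∞ :=
    hL1.trans_lt (ENNReal.mul_lt_top supConst_lt_top hu)
  have h1 : Integrable (fourierFn u) volume := ⟨aestronglyMeasurable_fourierFn u, hfin⟩
  have h2 : MemLp (fourierFn u) 2 volume := Lp.memLp (𝓕 u : L2C)
  have hLp : (𝓕⁻ (h2.toLp (fourierFn u)) : L2C) = u := by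
    have : h2.toLp (fourierFn u) = (𝓕 u : L2C) := Lp.toLp_coeFn (𝓕 u : L2C) h2
    rw [this]
    exact fourierInv_fourier_eq u
  have hae := SobolevEmbeddingHalf.enorm_fourierInv_toLp_le h1 h2
  rw [hLp] at hae
  rw [eLpNorm_exponent_top]
  exact (eLpNormEssSup_le_of_ae_enorm_bound hae).trans hL1

/-- `Thesis` with its conclusion strengthened to GLOBAL continuation: every Type-I-bounded mild solution
on `[0,T)` is the restriction of a global mild solution. [folklore] -/
def ThesisGlobal : Prop :=
  ∀ 𝒜 : AveragingDatum, 𝒜.IsSymmetric → 𝒜.HasCancellation → ∀ u₀ : 𝓢(ℝ³, ℝ³),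
    VectorCalculus.IsDivFree ⇑u₀ → ∀ T : ℝ, 0 < T → ∀ u : ℝ → L2C,
      𝒜.IsMildSolution (schwartzL2 u₀) (Ico 0 T) u →
        (∃ M : ℝ, ∀ t ∈ Ico 0 T, eLpNorm (u t) ⊤ volume ≤ ENNReal.ofReal (M / Real.sqrt (T - t))) →
          ∃ v : ℝ → L2C, 𝒜.IsMildSolution (schwartzL2 u₀) (Ici 0) v ∧ ∀ t ∈ Ico 0 T, v t = u t

/-- `ThesisGlobal → Thesis` (take `T' = T + 1` and restrict). [folklore] -/
theorem thesis_of_thesisGlobal (h : ThesisGlobal) : Thesis := by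
  intro 𝒜 hs hc u₀ hdiv T hT u hmild hrate
  obtain ⟨v, hv, hvu⟩ := h 𝒜 hs hc u₀ hdiv T hT u hmild hrate
  exact ⟨T + 1, by linarith, v, hv.mono Ico_subset_Ici_self, hvu⟩

/-- **The global strengthening is FALSE (modulo local existence): Theorem 1.5 bites a second time.**
Take Tao's blow-up datum `(𝒜, u₀)` (`averagedNS_blowup_holds`: no global mild solution) and a local mild
solution `u` on `[0,T₀)`; on `[0,T₀/2)` it is `H¹⁰`-bounded (`extension_H10_bounded`, the compactness
half of the continuation criterion, landed for crux #3), hence `L^∞`-bounded by the embedding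
`eLpNorm_top_le_eFourierSobolevNorm`, hence obeys the Type-I rate with `M = sup ‖u‖_∞ · √(T₀/2)`;
`ThesisGlobal` would continue it globally — contradiction. So the `∃ T' > T` shape of the conclusion of
`Thesis` is forced: continuation is only ever LOCAL past `T` (the solution may, and for Tao's datum does,
blow up later, at the Type-II rate). [cite: Tao2016AveragedNS, Thm. 1.5] -/
theorem thesisGlobal_false_of_localExistence
    (hloc : ∀ 𝒜 : AveragingDatum, 𝒜.IsSymmetric → 𝒜.HasCancellation → LocalExistenceFor 𝒜) :
    ¬ ThesisGlobal := by
  intro h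
  obtain ⟨𝒜, hs, hc, u₀, hdiv, hno⟩ := averagedNS_blowup_holds
  obtain ⟨T₀, hT₀, u, hu⟩ := hloc 𝒜 hs hc u₀ hdiv
  have hT : 0 < T₀ / 2 := by linarith
  have hlt : T₀ / 2 < T₀ := by linarith
  have hu' : 𝒜.IsMildSolution (schwartzL2 u₀) (Ico 0 (T₀ / 2)) u :=
    hu.mono (Ico_subset_Ico_right hlt.le)
  obtain ⟨C, hC⟩ := extension_H10_bounded (T := T₀ / 2) hlt hu (fun t _ => rfl)
  set B : ℝ≥0∞ := supConst * ENNReal.ofReal C with hB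
  have hBfin : B ≠ ∞ := ENNReal.mul_ne_top supConst_lt_top.ne ENNReal.ofReal_ne_top
  have hrate : ∃ M : ℝ, ∀ t ∈ Ico 0 (T₀ / 2),
      eLpNorm (u t) ⊤ volume ≤ ENNReal.ofReal (M / Real.sqrt (T₀ / 2 - t)) := by
    refine ⟨B.toReal * Real.sqrt (T₀ / 2), fun t ht => ?_⟩
    have hfin_t : eFourierSobolevNorm 10 (u t) < ∞ := (hC t ht).trans_lt ENNReal.ofReal_lt_top
    calc eLpNorm (u t) ⊤ volume ≤ supConst * eFourierSobolevNorm 10 (u t) :=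
          eLpNorm_top_le_eFourierSobolevNorm _ hfin_t
      _ ≤ B := by rw [hB]; gcongr; exact hC t ht
      _ = ENNReal.ofReal B.toReal := (ENNReal.ofReal_toReal hBfin).symm
      _ ≤ ENNReal.ofReal (B.toReal * Real.sqrt (T₀ / 2) / Real.sqrt (T₀ / 2 - t)) := by
          apply ENNReal.ofReal_le_ofReal
          have hpos : 0 < Real.sqrt (T₀ / 2 - t) := Real.sqrt_pos.2 (by linarith [ht.2])
          rw [le_div_iff₀ hpos]
          have hle : Real.sqrt (T₀ / 2 - t) ≤ Real.sqrt (T₀ / 2) :=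
            Real.sqrt_le_sqrt (by linarith [ht.1])
          exact mul_le_mul_of_nonneg_left hle ENNReal.toReal_nonneg
  obtain ⟨v, hv, -⟩ := h 𝒜 hs hc u₀ hdiv (T₀ / 2) hT u hu' hrate
  exact hno ⟨v, hv⟩

/-! ### 4a'. Normal form of the rate hypothesis: only the germ at `T` matters -/

/-- **Normal form: the Type-I rate hypothesis only matters near `T`.** `Thesis` is equivalent to its
version in which the bound `‖u(t)‖_∞ ≤ M(T-t)^{-1/2}` is assumed only on a final interval `[t₀, T)`,
`t₀ < T`: below any `T' < T` a mild solution is `H¹⁰`-bounded (`extension_H10_bounded`, compactness),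
hence `L^∞`-bounded (`eLpNorm_top_le_eFourierSobolevNorm`), and `(T-t)^{-1/2} ≥ T^{-1/2}` there. For
the disprover: a witness need only be Type I in the limit `t ↑ T`; for the prover: the bound may be
assumed on all of `[0,T)` at no cost. [folklore] -/
theorem thesis_iff_eventualRate :
    Thesis ↔ ∀ 𝒜 : AveragingDatum, 𝒜.IsSymmetric → 𝒜.HasCancellation →
      ∀ u₀ : 𝓢(ℝ³, ℝ³), VectorCalculus.IsDivFree ⇑u₀ →
        ∀ T : ℝ, 0 < T → ∀ u : ℝ → L2C, 𝒜.IsMildSolution (schwartzL2 u₀) (Ico 0 T) u →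
          (∃ t₀ M : ℝ, t₀ < T ∧ ∀ t ∈ Ico 0 T, t₀ ≤ t →
              eLpNorm (u t) ⊤ volume ≤ ENNReal.ofReal (M / Real.sqrt (T - t))) →
            ∃ T' : ℝ, T < T' ∧ ∃ v : ℝ → L2C,
              𝒜.IsMildSolution (schwartzL2 u₀) (Ico 0 T') v ∧ ∀ t ∈ Ico 0 T, v t = u t := by
  constructor
  · intro h 𝒜 hs hc u₀ hdiv T hT u hu hev
    refine h 𝒜 hs hc u₀ hdiv T hT u hu ?_
    obtain ⟨t₀, M, ht₀T, hM⟩ := hev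
    set s := max t₀ 0 with hs_def
    have hsT : s < T := max_lt ht₀T hT
    set T' := (s + T) / 2 with hT'_def
    have hT'T : T' < T := by rw [hT'_def]; linarith
    have hsT' : s < T' := by rw [hT'_def]; linarith
    obtain ⟨C, hC⟩ := extension_H10_bounded (T := T') hT'T hu (fun t _ => rfl)
    set B : ℝ≥0∞ := supConst * ENNReal.ofReal C with hB
    have hBfin : B ≠ ∞ := ENNReal.mul_ne_top supConst_lt_top.ne ENNReal.ofReal_ne_top
    refine ⟨max (B.toReal * Real.sqrt T) M, fun t ht => ?_⟩
    have hpos : 0 < Real.sqrt (T - t) := Real.sqrt_pos.2 (by linarith [ht.2])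
    by_cases hts : t < s
    · have htT' : t ∈ Ico 0 T' := ⟨ht.1, hts.trans hsT'⟩
      have hfin_t : eFourierSobolevNorm 10 (u t) < ∞ := (hC t htT').trans_lt ENNReal.ofReal_lt_top
      calc eLpNorm (u t) ⊤ volume ≤ supConst * eFourierSobolevNorm 10 (u t) :=
            eLpNorm_top_le_eFourierSobolevNorm _ hfin_t
        _ ≤ B := by rw [hB]; gcongr; exact hC t htT'
        _ = ENNReal.ofReal B.toReal := (ENNReal.ofReal_toReal hBfin).symm
        _ ≤ ENNReal.ofReal (max (B.toReal * Real.sqrt T) M / Real.sqrt (T - t)) := by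
            apply ENNReal.ofReal_le_ofReal
            rw [le_div_iff₀ hpos]
            have hle : Real.sqrt (T - t) ≤ Real.sqrt T := Real.sqrt_le_sqrt (by linarith [ht.1])
            calc B.toReal * Real.sqrt (T - t) ≤ B.toReal * Real.sqrt T :=
                  mul_le_mul_of_nonneg_left hle ENNReal.toReal_nonneg
              _ ≤ max (B.toReal * Real.sqrt T) M := le_max_left _ _
    · have ht₀t : t₀ ≤ t := (le_max_left t₀ 0).trans (not_lt.1 hts)
      refine (hM t ht ht₀t).trans (ENNReal.ofReal_le_ofReal ?_)
      exact div_le_div_of_nonneg_right (le_max_right _ _) hpos.le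
  · intro h 𝒜 hs hc u₀ hdiv T hT u hu hrate
    refine h 𝒜 hs hc u₀ hdiv T hT u hu ?_
    obtain ⟨M, hM⟩ := hrate
    exact ⟨0, M, hT, fun t ht _ => hM t ht⟩

/-! ### 4b. The rate EXPONENT cannot be raised; the rate CONSTANT is free (prose)

* `Thesis_β` := `Thesis` with `(T-t)^{-1/2}` replaced by `(T-t)^{-β}`. For `β < 1/2` the hypothesis is
  STRONGER and `Thesis_β` is expected TRUE class-wide by the abstract energy method (Serrin class via
  `L^p` multiplier bounds, `p < ∞`; Cruxes/AveragedTypeIBlowup §5). For `β > 1/2` the hypothesis is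
  weaker and `Thesis_β` is FALSE as soon as `β ≥ β_Tao`: Tao's own witness (Theorem 1.5) has, by p. 8 of
  arXiv:1402.0290, energy fraction `≥ (1+ε₀)^{-εn}` inside `B(0,(1+ε₀)^{-n})` at times `t_n` with
  `T_* - t_n ≈ (1+ε₀)^{-(5/2-O(ε))n}`, whence `‖u(t_n)‖_∞ ≳ N_n^{3/2-ε/2}` ≈ `(T_*-t_n)^{-3/5+O(ε)}`:
  `β_Tao = 3/5 - O(ε)`. Formalising `¬ Thesis_{3/5}` would need an `L^∞` UPPER bound along Tao's
  solution up to `T_*` (quantitative control of the whole cascade tail) — not attempted.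
  EXPECTED (mechanism, not in print): every `β ∈ (1/2, 3/5]` is realised by a DUMP-MODE variant of Tao's
  circuit that diverts a fixed fraction `δ` of each scale's energy into an inert same-scale mode (energy
  reaching scale `N` is `N^{-γ}`, `γ = -log(1-δ)/log(1+ε₀)`; amplitude `N^{(3-γ)/2}`, step time
  `N^{-(5-γ)/2}`, so `β = (3-γ)/(5-γ) ∈ (1/2, 3/5]` for `γ ∈ [0,1)`), dissipation staying perturbative
  for every `γ < 1` (`N² · N^{-(5-γ)/2} = N^{(γ-1)/2} → 0`). So `β = 1/2` (`γ = 1`) is EXACTLY the first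
  exponent at which Tao's perturbative engine stalls (dissipation `O(1)`-relevant at every step): the crux
  sits on the boundary from both sides. CAVEAT: the backbone must be an ABRUPT circuit (Tao §5); on the
  plain scalar Katz–Pavlović backbone transfers are incomplete and interfere, and the viscous chain at
  `α = 2/5` is globally regular for non-negative data (barrier `DyadicCascadeRegularity`, BMR 2011), so a
  dump-gated KP toy would show nothing — which is why no kit toy was run this cycle (the CircuitPump seats
  own the circuit numerics). AT `γ = 1` the same bookkeeping predicts the Type-I object as a THRESHOLD: with
  nonlinear/dissipative rate ratio `A_n` at the front, one step gives `A_{n+1} ≈ A_n (1+η/2) - c/2`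
  (`1+η = lam^{2/5}(1-δ)` the super-criticality left by the dump, `c/A_n` the viscous loss), an UNSTABLE
  fixed point `A* = c/η`: above it Tao's Type-II runaway, below it decay, AT it a DSS Type-I orbit of
  codimension one — consistent with crux #3's disprover (Cruxes/AveragedTypeIBlowup §7, §10(a)) and with
  the `m = 2` threshold orbits seen numerically (Cruxes/CircuitPump/TRIAGE-r1-3.md §A).
* the constant `M`: free (§3d).

## 5. Why the crux resists (both ways)

* PROOF side: `Thesis` CONTAINS forward Type-I exclusion for the true Navier–Stokes equations in Tao's
  mild class (`thesis_imp_nsTypeIExclusion` below; the Euler datum is in the class) — the open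
  KNSS / Seregin–Šverák tier (`Literature.Analysis.FluidPDE.LiouvilleConjectureNS` is a `@[conjecture]`;
  barrier `AxisymmetricTypeIExclusion`: proved only under axisymmetry, by fine-structure tools). No cheap
  proof.
* DISPROOF side: `¬ Thesis` is an AUTONOMOUS in-class Type-I-rate blow-up (§1, reduced to the cascade
  equation in §2). In print: none. Tao's blow-up is Type II (`β = 3/5 - O(ε)`); the only Type-I-rate
  witness on the board, `Literature.Barriers.NavierStokesRegularity.TruncatedDyadicTypeIBlowup`
  (`TruncatedDyadic.Tao2016_prop51_dss`, Prop. 5.1 at the endpoint `δ = 1-2α`), is an ODE with an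
  EXOGENOUS clock — a time-dependent coupling is not an `AveragingDatum` (the structure has no time
  argument), so it does not bite `Thesis`; it only shows that a proof of `Thesis` must use AUTONOMY (plus
  whatever else), cf. the facet's `scope_caveats (ii)`. The ancient/DSS object behind any autonomous
  witness is crux CircuitPump (#2); its transfer is PumpTransfer (#5).
* MECHANISM obstruction at `β = 1/2` (why Tao's engine does not simply extend): Type-I timing gives each
  scale step only `O(1)` dissipation times, forever; Tao's §5 circuit is powered by a SEPARATION of time
  scales inside each step (slow `ε`-pump ignition, then fast rotor transfer — "abrupt" and delayed), and a
  slow ignition phase is killed by `O(1)` dissipation acting during the delay. A Type-I pump must fire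
  within `O(1)` turnover times with `O(1)` losses at EVERY scale — a different, non-abrupt circuit
  (numerics of the sibling seats: the `m = 1` scalar chain does not pump at `α = 2/5`,
  Cruxes/CircuitPump/ScalarNumericsC1.md; an `m = 2` seeded graded Toda chain shows `k = 1` DSS Type-I
  threshold orbits at `lam = 2, 1.5`, Cruxes/CircuitPump/TRIAGE-r1-3.md §A — if that survives and
  transfers, `Thesis` is false).
* JUNK audit of the universal statement (a `∀` over a WIDENED class is a stronger claim, so widenings
  matter here, unlike for Theorem 1.5): the tree's `AveragingDatum` widens Tao's (1.13) only by recording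
  pointwise (instead of Fréchet–Borel) measurability of `θ ↦ m_{i,θ}`; with symbols continuous off the
  origin this gives joint measurability, and the moment bounds give absolute convergence of (1.13) on
  `H¹⁰_df` (Tao p. 7), so `form` carries no Bochner junk on the arguments the mild identity uses; symbols,
  rotations, dilations, moment bounds are exactly Tao's. No junk member of the class is available to
  falsify `Thesis` for the wrong reason. -/

/-- **`Thesis` contains Navier–Stokes Type-I exclusion** (PROOF-side obstruction): if `Thesis` holds then
every `H¹⁰_df`-mild solution of the true Navier–Stokes equations (`ν = 1`, Euler datum, `B̃ = B`) from
Schwartz divergence-free data obeying the Type-I rate on `[0,T)` extends past `T` — the open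
KNSS / Seregin–Šverák-tier statement. [cite: KochNadirashviliSereginSverak2009, §1] -/
theorem thesis_imp_nsTypeIExclusion (h : Thesis) :
    ∀ u₀ : 𝓢(ℝ³, ℝ³), VectorCalculus.IsDivFree ⇑u₀ → ∀ T : ℝ, 0 < T → ∀ u : ℝ → L2C,
      AveragingDatum.euler.IsMildSolution (schwartzL2 u₀) (Ico 0 T) u →
      (∃ M : ℝ, ∀ t ∈ Ico 0 T, eLpNorm (u t) ⊤ volume ≤ ENNReal.ofReal (M / Real.sqrt (T - t))) →
      ∃ T' : ℝ, T < T' ∧ ∃ v : ℝ → L2C,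
        AveragingDatum.euler.IsMildSolution (schwartzL2 u₀) (Ico 0 T') v ∧ ∀ t ∈ Ico 0 T, v t = u t :=
  nsTypeI_extends_of_not_averagedTypeIBlowup (thesis_iff_not_averagedTypeIBlowup.1 h)

end Summit.NavierStokesRegularity.NavierStokesRegularity.Cruxes.Thesis.Disproof

end
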